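import Literature.NumberTheory.EllipticCurves.FormalGroupMultiplicationUniversalProofs
import Literature.NumberTheory.EllipticCurves.FormalGroupLawAxiomsUniversalProofs
import HarnessLib

/-!
# `[n]` and the inverse `i` are ENDOMORPHISMS of the formal group law of a Weierstrass curve,
# over every commutative ring: `[n](F(z₁, z₂)) = F([n]z₁, [n]z₂)`, `i(F(z₁, z₂)) = F(i z₁, i z₂)`
# (Silverman AEC IV.2.3; proofs only)

Topic `NumberTheory/EllipticCurves` (theorems only). The tree has the formal-group axioms over every ring
(`FormalGroupLawAxiomsUniversalProofs`) and the one-variable identities `[m + n] = F([m], [n])`,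
`[m] ∘ [n] = [mn]` (`FormalGroupMultiplicationUniversalProofs`), but not the two-variable statement that the
multiplication maps and the inverse commute with the group law — the hypothesis "`f ∈ End(F)`"
(`f ∘ F = F ∘ (f × f)`) under which Lubin–Tate's uniqueness lemma identifies a formal group law
(`GaloisRepresentations/LubinTate`, `LubinTate.exists_unique`). Same method as those files: over a
`ℚ`-algebra domain both sides have the same formal logarithm (`n·(log z₁ + log z₂)`, resp.
`−(log z₁ + log z₂)`), then transfer along `ℤ[a₁,…,a₆] ↪ ℚ[a₁,…,a₆]` and specialise.
PRECEDENT (Summits side, not importable from `Literature/`): route `CyclotomicUntwist`'s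
`Summit.BirchSwinnertonDyer.BirchSwinnertonDyer.Theorems.FormalEndomorphismAlgebra.hom_formalMul / hom_formalNeg /
hom_comp` (file `Summits/…/Theorems/CyclotomicUntwistFormalEndomorphismAlgebra.lean`, from the universal axioms by
substitution) prove the same two identities; they are restated here at `Literature` level, with an independent
proof, so that `Literature` files (the Lubin–Tate road of `SupersingularFormalMulFrobenius`) can import them.

* `formalMul_subst_formalGroupLaw'` — `[n](F(z₁, z₂)) = F([n](z₁), [n](z₂))` in `R⟦z₁, z₂⟧`;
* `formalNeg_subst_formalGroupLaw'` — `i(F(z₁, z₂)) = F(i(z₁), i(z₂))`;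
* `formalNeg_subst_formalMul_subst_formalGroupLaw'` — the same for `[−n] := i ∘ [n]`.

## References
* [SilvermanAEC2009] J. H. Silverman, *The Arithmetic of Elliptic Curves*, 2nd ed. (2009), IV.2.3, IV.5.5.
-/

noncomputable section

open PowerSeries Literature.NumberTheory.EllipticCurves

namespace WeierstrassCurve

/-! ### Generic substitution bookkeeping -/

section Subst

variable {R : Type*} [CommRing R]

/-- `z_i` has no constant term. [folklore] -/
private theorem constantCoeff_X_fin (i : Fin 2) :
    MvPowerSeries.constantCoeff (MvPowerSeries.X i : MvPowerSeries (Fin 2) R) = 0 :=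
  MvPowerSeries.constantCoeff_X i

/-- `f(z_i)` has no constant term when `f(0) = 0`. [folklore] -/
private theorem constantCoeff_subst_X_fin {f : R⟦X⟧} (hf : constantCoeff f = 0) (i : Fin 2) :
    MvPowerSeries.constantCoeff (f.subst (MvPowerSeries.X i : MvPowerSeries (Fin 2) R)) = 0 :=
  PowerSeries.constantCoeff_subst_eq_zero (MvPowerSeries.constantCoeff_X i) f hf

/-- `f(F(z₁, z₂))` has no constant term when `f(0) = 0`. [folklore] -/
private theorem constantCoeff_subst_formalGroupLaw (W : WeierstrassCurve R) {f : R⟦X⟧} (hf : constantCoeff f = 0) :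
    MvPowerSeries.constantCoeff (f.subst W.formalGroupLaw) = 0 :=
  PowerSeries.constantCoeff_subst_eq_zero W.constantCoeff_formalGroupLaw f hf

/-- `map φ (f(z_i)) = (map φ f)(z_i)`. [folklore] -/
private theorem map_subst_X_fin {S : Type*} [CommRing S] (φ : R →+* S) (f : R⟦X⟧) (i : Fin 2) :
    MvPowerSeries.map φ (f.subst (MvPowerSeries.X i : MvPowerSeries (Fin 2) R)) =
      (PowerSeries.map φ f).subst (MvPowerSeries.X i : MvPowerSeries (Fin 2) S) := by
  rw [PowerSeries.map_subst (PowerSeries.HasSubst.X i), MvPowerSeries.map_X]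

/-- `map φ (f(F_W)) = (map φ f)(F_{W ⊗ S})`. [folklore] -/
private theorem map_subst_formalGroupLaw {S : Type*} [CommRing S] (φ : R →+* S) (W : WeierstrassCurve R) (f : R⟦X⟧) :
    MvPowerSeries.map φ (f.subst W.formalGroupLaw) = (PowerSeries.map φ f).subst (W.map φ).formalGroupLaw := by
  rw [PowerSeries.map_subst W.hasSubst_formalGroupLaw, map_formalGroupLaw]

end Subst

/-! ### Over a `ℚ`-algebra domain -/

section RatDomain

variable {A : Type*} [CommRing A] [Algebra ℚ A] [IsDomain A] (V : WeierstrassCurve A)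

omit [IsDomain A] in
/-- `log_W(f(F)) = (log_W ∘ f)(F)` bookkeeping: `log(g(z_i)) = (log ∘ g)(z_i)`. [folklore] -/
private theorem formalLog_subst_subst_X {g : A⟦X⟧} (hg : constantCoeff g = 0) (i : Fin 2) :
    V.formalLog.subst (g.subst (MvPowerSeries.X i : MvPowerSeries (Fin 2) A)) =
      PowerSeries.subst (MvPowerSeries.X i : MvPowerSeries (Fin 2) A) (V.formalLog.subst g) :=
  (PowerSeries.subst_comp_subst_apply (PowerSeries.HasSubst.of_constantCoeff_zero' hg)
    (PowerSeries.HasSubst.X i) V.formalLog).symm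

/-- **`[n](F(z₁, z₂)) = F([n]z₁, [n]z₂)` over a `ℚ`-algebra domain**: both sides have logarithm
`n · (log z₁ + log z₂)`. [cite: SilvermanAEC2009, IV.2.3] -/
theorem formalMul_subst_formalGroupLaw_rat (n : ℕ) :
    (V.formalMul n).subst V.formalGroupLaw =
      MvPowerSeries.subst ![(V.formalMul n).subst (MvPowerSeries.X 0 : MvPowerSeries (Fin 2) A),
        (V.formalMul n).subst (MvPowerSeries.X 1 : MvPowerSeries (Fin 2) A)] V.formalGroupLaw := by
  have h0 := constantCoeff_subst_X_fin (V.constantCoeff_formalMul n) 0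
  have h1 := constantCoeff_subst_X_fin (V.constantCoeff_formalMul n) 1
  refine V.eq_of_formalLog_subst_eq (V.constantCoeff_subst_formalGroupLaw (V.constantCoeff_formalMul n))
    (MvPowerSeries.constantCoeff_subst_eq_zero (hasSubst_pair h0 h1)
      (fun k => by fin_cases k <;> assumption) V.constantCoeff_formalGroupLaw) ?_
  rw [V.formalLog_subst_subst_pair_formalGroupLaw h0 h1, V.formalLog_subst_subst_X (V.constantCoeff_formalMul n),
    V.formalLog_subst_subst_X (V.constantCoeff_formalMul n), formalLog_subst_formalMul_rat,
    ← PowerSeries.subst_comp_subst_apply (V.hasSubst_formalMul n) V.hasSubst_formalGroupLaw,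
    formalLog_subst_formalMul_rat,
    ← PowerSeries.coe_substAlgHom V.hasSubst_formalGroupLaw, map_nsmul, PowerSeries.coe_substAlgHom,
    V.formalLog_subst_formalGroupLaw,
    ← PowerSeries.coe_substAlgHom (PowerSeries.HasSubst.X (0 : Fin 2)), map_nsmul, PowerSeries.coe_substAlgHom,
    ← PowerSeries.coe_substAlgHom (PowerSeries.HasSubst.X (1 : Fin 2)), map_nsmul, PowerSeries.coe_substAlgHom,
    nsmul_add]

/-- **`i(F(z₁, z₂)) = F(i z₁, i z₂)` over a `ℚ`-algebra domain**: both sides have logarithm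
`−(log z₁ + log z₂)`. [cite: SilvermanAEC2009, IV.2.3] -/
theorem formalNeg_subst_formalGroupLaw_rat :
    V.formalNeg.subst V.formalGroupLaw =
      MvPowerSeries.subst ![V.formalNeg.subst (MvPowerSeries.X 0 : MvPowerSeries (Fin 2) A),
        V.formalNeg.subst (MvPowerSeries.X 1 : MvPowerSeries (Fin 2) A)] V.formalGroupLaw := by
  have h0 := constantCoeff_subst_X_fin V.constantCoeff_formalNeg 0
  have h1 := constantCoeff_subst_X_fin V.constantCoeff_formalNeg 1
  have hsN : PowerSeries.HasSubst V.formalNeg := PowerSeries.HasSubst.of_constantCoeff_zero' V.constantCoeff_formalNeg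
  refine V.eq_of_formalLog_subst_eq (V.constantCoeff_subst_formalGroupLaw V.constantCoeff_formalNeg)
    (MvPowerSeries.constantCoeff_subst_eq_zero (hasSubst_pair h0 h1)
      (fun k => by fin_cases k <;> assumption) V.constantCoeff_formalGroupLaw) ?_
  rw [V.formalLog_subst_subst_pair_formalGroupLaw h0 h1, V.formalLog_subst_subst_X V.constantCoeff_formalNeg,
    V.formalLog_subst_subst_X V.constantCoeff_formalNeg, formalLog_subst_formalNeg,
    ← PowerSeries.subst_comp_subst_apply hsN V.hasSubst_formalGroupLaw, formalLog_subst_formalNeg,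
    ← PowerSeries.coe_substAlgHom V.hasSubst_formalGroupLaw, map_neg, PowerSeries.coe_substAlgHom,
    V.formalLog_subst_formalGroupLaw,
    ← PowerSeries.coe_substAlgHom (PowerSeries.HasSubst.X (0 : Fin 2)), map_neg, PowerSeries.coe_substAlgHom,
    ← PowerSeries.coe_substAlgHom (PowerSeries.HasSubst.X (1 : Fin 2)), map_neg, PowerSeries.coe_substAlgHom,
    neg_add]

end RatDomain

/-! ### Over every commutative ring -/

section AnyRing

variable {R : Type*} [CommRing R] (W : WeierstrassCurve R)

/-- Transfer of an identity `f_W(F_W) = F_W(f_W z₁, f_W z₂)` along a ring map, for a natural family `f`.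
[folklore] -/
private theorem map_endo_identity {S : Type*} [CommRing S] (φ : R →+* S) {f : R⟦X⟧} (hf : constantCoeff f = 0) :
    MvPowerSeries.map φ (MvPowerSeries.subst ![f.subst (MvPowerSeries.X 0 : MvPowerSeries (Fin 2) R),
        f.subst (MvPowerSeries.X 1 : MvPowerSeries (Fin 2) R)] W.formalGroupLaw) =
      MvPowerSeries.subst ![(PowerSeries.map φ f).subst (MvPowerSeries.X 0 : MvPowerSeries (Fin 2) S),
        (PowerSeries.map φ f).subst (MvPowerSeries.X 1 : MvPowerSeries (Fin 2) S)] (W.map φ).formalGroupLaw := by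
  rw [W.map_subst_pair_formalGroupLaw φ (constantCoeff_subst_X_fin hf 0) (constantCoeff_subst_X_fin hf 1),
    map_subst_X_fin, map_subst_X_fin]

/-- **`[n]` is an endomorphism of the formal group law of every Weierstrass curve over every commutative
ring**: `[n](F(z₁, z₂)) = F([n](z₁), [n](z₂))` in `R⟦z₁, z₂⟧`. [cite: SilvermanAEC2009, IV.2.3] -/
theorem formalMul_subst_formalGroupLaw' (n : ℕ) :
    (W.formalMul n).subst W.formalGroupLaw =
      MvPowerSeries.subst ![(W.formalMul n).subst (MvPowerSeries.X 0 : MvPowerSeries (Fin 2) R),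
        (W.formalMul n).subst (MvPowerSeries.X 1 : MvPowerSeries (Fin 2) R)] W.formalGroupLaw := by
  have hQ := (universalInt.map (MvPolynomial.map (Int.castRingHom ℚ))).formalMul_subst_formalGroupLaw_rat n
  have hZ : (universalInt.formalMul n).subst universalInt.formalGroupLaw =
      MvPowerSeries.subst ![(universalInt.formalMul n).subst (MvPowerSeries.X 0 : MvPowerSeries (Fin 2) _),
        (universalInt.formalMul n).subst (MvPowerSeries.X 1 : MvPowerSeries (Fin 2) _)] universalInt.formalGroupLaw := by
    apply mvPowerSeries_map_injective mvPolynomial_map_int_rat_injective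
    rw [map_subst_formalGroupLaw, map_formalMul, hQ,
      map_endo_identity _ _ (constantCoeff_formalMul _ n), map_formalMul]
  have hR := congrArg (MvPowerSeries.map W.universalEval) hZ
  rwa [map_subst_formalGroupLaw, map_formalMul, map_endo_identity _ _ (constantCoeff_formalMul _ n), map_formalMul,
    universalInt_map] at hR

/-- **The inverse `i` is an endomorphism of the formal group law (commutativity) over every commutative
ring**: `i(F(z₁, z₂)) = F(i(z₁), i(z₂))` in `R⟦z₁, z₂⟧`. [cite: SilvermanAEC2009, IV.2.3] -/
theorem formalNeg_subst_formalGroupLaw' :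
    W.formalNeg.subst W.formalGroupLaw =
      MvPowerSeries.subst ![W.formalNeg.subst (MvPowerSeries.X 0 : MvPowerSeries (Fin 2) R),
        W.formalNeg.subst (MvPowerSeries.X 1 : MvPowerSeries (Fin 2) R)] W.formalGroupLaw := by
  have hQ := (universalInt.map (MvPolynomial.map (Int.castRingHom ℚ))).formalNeg_subst_formalGroupLaw_rat
  have hZ : universalInt.formalNeg.subst universalInt.formalGroupLaw =
      MvPowerSeries.subst ![universalInt.formalNeg.subst (MvPowerSeries.X 0 : MvPowerSeries (Fin 2) _),
        universalInt.formalNeg.subst (MvPowerSeries.X 1 : MvPowerSeries (Fin 2) _)] universalInt.formalGroupLaw := by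
    apply mvPowerSeries_map_injective mvPolynomial_map_int_rat_injective
    rw [map_subst_formalGroupLaw, map_formalNeg, hQ, map_endo_identity _ _ (constantCoeff_formalNeg _), map_formalNeg]
  have hR := congrArg (MvPowerSeries.map W.universalEval) hZ
  rwa [map_subst_formalGroupLaw, map_formalNeg, map_endo_identity _ _ (constantCoeff_formalNeg _), map_formalNeg,
    universalInt_map] at hR

/-- **`[−n] := i ∘ [n]` is an endomorphism of the formal group law over every commutative ring**:
`(i ∘ [n])(F(z₁, z₂)) = F((i ∘ [n]) z₁, (i ∘ [n]) z₂)`. [cite: SilvermanAEC2009, IV.2.3] -/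
theorem formalNeg_subst_formalMul_subst_formalGroupLaw' (n : ℕ) :
    PowerSeries.subst W.formalGroupLaw (W.formalNeg.subst (W.formalMul n)) =
      MvPowerSeries.subst ![PowerSeries.subst (MvPowerSeries.X 0 : MvPowerSeries (Fin 2) R) (W.formalNeg.subst (W.formalMul n)),
        PowerSeries.subst (MvPowerSeries.X 1 : MvPowerSeries (Fin 2) R) (W.formalNeg.subst (W.formalMul n))]
        W.formalGroupLaw := by
  have hsn : PowerSeries.HasSubst (W.formalMul n) := W.hasSubst_formalMul n
  have hsN : PowerSeries.HasSubst W.formalNeg := PowerSeries.HasSubst.of_constantCoeff_zero' W.constantCoeff_formalNeg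
  have h0 := constantCoeff_subst_X_fin (W.constantCoeff_formalMul n) 0
  have h1 := constantCoeff_subst_X_fin (W.constantCoeff_formalMul n) 1
  have hsF : PowerSeries.HasSubst ((W.formalMul n).subst W.formalGroupLaw) :=
    PowerSeries.HasSubst.of_constantCoeff_zero (W.constantCoeff_subst_formalGroupLaw (W.constantCoeff_formalMul n))
  -- `(i ∘ [n])(F) = i([n](F)) = i(F([n]z₁, [n]z₂)) = F(i[n]z₁, i[n]z₂)`
  rw [PowerSeries.subst_comp_subst_apply hsn W.hasSubst_formalGroupLaw, W.formalMul_subst_formalGroupLaw' n]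
  -- `i(F(u, v)) = F(i u, i v)` for `u = [n]z₁`, `v = [n]z₂`: substitute into `formalNeg_subst_formalGroupLaw'`
  have hpair : PowerSeries.HasSubst (MvPowerSeries.subst ![(W.formalMul n).subst (MvPowerSeries.X 0 : MvPowerSeries (Fin 2) R),
      (W.formalMul n).subst (MvPowerSeries.X 1 : MvPowerSeries (Fin 2) R)] W.formalGroupLaw) := by
    rw [← W.formalMul_subst_formalGroupLaw' n]; exact hsF
  have hs01 : MvPowerSeries.HasSubst ![(W.formalMul n).subst (MvPowerSeries.X 0 : MvPowerSeries (Fin 2) R),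
      (W.formalMul n).subst (MvPowerSeries.X 1 : MvPowerSeries (Fin 2) R)] := hasSubst_pair h0 h1
  have key := congrArg (MvPowerSeries.subst ![(W.formalMul n).subst (MvPowerSeries.X 0 : MvPowerSeries (Fin 2) R),
      (W.formalMul n).subst (MvPowerSeries.X 1 : MvPowerSeries (Fin 2) R)]) W.formalNeg_subst_formalGroupLaw'
  rw [mvSubst_powerSeries_subst W.hasSubst_formalGroupLaw hs01,
    MvPowerSeries.subst_comp_subst_apply (hasSubst_pair (constantCoeff_subst_X_fin W.constantCoeff_formalNeg 0)
      (constantCoeff_subst_X_fin W.constantCoeff_formalNeg 1)) hs01] at key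
  rw [key]
  congr 1
  refine funext fun i => ?_
  revert i
  rw [Fin.forall_fin_two]
  refine ⟨?_, ?_⟩
  · simp only [Matrix.cons_val_zero]
    rw [mvSubst_powerSeries_subst (PowerSeries.HasSubst.X 0) hs01 W.formalNeg, MvPowerSeries.subst_X hs01,
      Matrix.cons_val_zero, PowerSeries.subst_comp_subst_apply hsn (PowerSeries.HasSubst.X 0)]
  · simp only [Matrix.cons_val_one, Matrix.cons_val_zero]
    rw [mvSubst_powerSeries_subst (PowerSeries.HasSubst.X 1) hs01 W.formalNeg, MvPowerSeries.subst_X hs01,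
      Matrix.cons_val_one, Matrix.cons_val_zero, PowerSeries.subst_comp_subst_apply hsn (PowerSeries.HasSubst.X 1)]

end AnyRing

end WeierstrassCurve

end
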